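import Mathlib
import Summits.ValiantsHypothesis.ValiantsHypothesis.Theorems.FeketeSOSCharPSparseSOSCoreSumClique

/-!
# Crux `FeketeSOS.CharPSparseSOS` (stmt-ValiantsHypothesis-14989) — the DIFFERENCE-set wall:
the crux implies a power-saving Lev–Sonn theorem and an additive power below Hanson–Petridis
for Sidon Paley cliques

All calibrations of the crux so far (`no_qrPerfectSumSet_of_charPSparseSOS`,
`rQ_far_from_QR_of_charPSparseSOS`, `coreSumClique_of_charPSparseSOS`, the multi-piece wall) read the
cheap side through RESTRICTED SUMSETS `a + b`, `a < b` (Shkredov 2014 / Yip 2025 territory).  This file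
records the twin wall on the DIFFERENCE side, which is absent from the sum-side files and is the side on
which the classical literature is sharpest.

For a prime `p` and `Q ⊆ [0, p)` let `d_Q(n) = #{(a, b) ∈ Q × Q : a ≠ b, a − b ≡ n (mod p)}` be the
ordered off-diagonal difference count (written below with natural numbers as
`#{(a,b) ∈ Q.offDiag : (a + (p − b)) % p = n}`) and `1_QR(n) = [n ≠ 0, (n|p) = 1]`.  With
`Cq = ∑_{a∈Q} X^a` and the REFLECTED polynomial `C̃q = ∑_{b∈Q} X^{(p−b) mod p}` one has the fold identity
`Cq · C̃q ≡ |Q| + ∑_n d_Q(n) X^n (mod X^p − 1)` (`dsb_fold_identity`, no hypothesis on `Q` beyond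
`Q ⊆ [0,p)`), and since a product is two squares, `2·Cq·C̃q = ½(Cq + C̃q)² − ½(Cq − C̃q)²`, the Fekete
pattern `F̄_p = 2 ∑ 1_QR(n) X^n − (X + ⋯ + X^{p−1})`, the digit tiling of the all-ones polynomial and the
error polynomial `Er = ∑ (d_Q(n) − 1_QR(n)) X^n` give an EIGHT-square cyclic representation
`F̄_p ≡ ½(Cq+C̃q)² − ½(Cq−C̃q)² − ¼(P+Q)² + ¼(P−Q)² − ¼(M+T)² + ¼(M−T)² − ½(1+E)² + ½(1−E)²`,
`E = |Q| + Er`, of degree `< p` and support-sum `≤ 4|Q| + 2e + 6√p + 10` (`dsb_witness`).  Hence: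

* `dQ_far_from_QR_of_charPSparseSOS` — the crux (with its exponent `δ`) forces, for all large primes and
  EVERY `Q ⊆ [0, p)`, `p^{1/2+δ} ≤ 4|Q| + 2·#{n < p : d_Q(n) ≠ 1_QR(n)} + 13√p + 13`: the indicator of the
  quadratic residues is `p^{1/2+δ}`-far from the ordered difference function of every set of size
  `≲ p^{1/2+δ}/4`.  The exact case `e = 0` — a set `A ⊆ 𝔽_p` every quadratic residue being `a′ − a″`
  (`a′ ≠ a″` in `A`) for exactly one ordered pair and no non-residue so represented — is the problem of
  V. F. Lev and J. Sonn, *Quadratic residues and difference sets*, Q. J. Math. 68 (2017) 79–95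
  (arXiv:1502.06833; necessary conditions, no such `A` for `13 < p < 10^18`), reduced to by B. Hanson,
  G. Petridis, Proc. LMS 122 (2021), Cor. 6 (any `A ∸ A = QR` is of this unique kind) and now SETTLED by
  A. Kalmynin, *On additive irreducibility of multiplicative subgroups* (arXiv:2504.10202, 2025), Thm. 1:
  `A − A = μ_d ∪ {0}` forces `d ∈ {2, 6}`, i.e. only `p = 5, 13` — by the Hanson–Petridis polynomials, with
  `O(1)` error tolerance.  So, exactly as on the sum side (exact problem = Shkredov's theorem), the exact
  statement belongs to the polynomial method and the crux is its POWER-SAVING form (`e` up to `p^{1/2+δ}/2`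
  disagreements), for which nothing is in print (CORRECTION of this docstring's first revision, p164344, which
  called the exact problem open).
* the clique form — every SIDON PALEY CLIQUE `C ⊆ 𝔽_p` has `|C| ≤ √(p/2) − p^δ/3 + 13/2`, an additive
  power below Hanson–Petridis 2021 Cor. 5 (`|C|(|C|−1) ≤ (p−1)/2`, which for Sidon cliques is exactly the
  counting bound; its equality case is classified by Kalmynin 2025, Thm. 4 — only `p = 5, 13, 41` — so in
  print the bound is `|C|(|C|−1) ≤ (p−1)/2 − 1` for `p > 41`, ONE unit, against the `≍ p^{1/2+δ}` units the
  crux needs) — is derived from `dQ_far_from_QR_of_charPSparseSOS` in the sequel file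
  `FeketeSOSCharPSparseSOSSidonPaleyClique.lean` (`sidonPaleyClique_card_le_of_charPSparseSOS`).

(Lead c9 of the crux; `--supports` stmt-ValiantsHypothesis-14989.)
-/

-- `Summit.ValiantsHypothesis.ValiantsHypothesis.…` is the tree's mandated single-conjunct layout (Sub = Summit).
set_option linter.dupNamespace false

namespace Summit.ValiantsHypothesis.ValiantsHypothesis.Theorems.CharPSparseSOSTwoCusp

open Polynomial Finset
open Summit.ValiantsHypothesis.ValiantsHypothesis.Theorems.CharPSparseSOS.Negative
  (lowDigits highDigits card_support_add_le card_support_sub_le card_support_sum_le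
    card_support_sum_X_pow_le card_support_X_pow_le card_support_lowDigits card_support_highDigits
    natDegree_lowDigits natDegree_highDigits ones_digit_identity four_ne_zero_zmod)

noncomputable section

variable {K : Type} [Field K]

/-! ## Folding the product `Cq · C̃q` modulo `X^p − 1` -/

/-- Folding the product of the monomial sum and its reflection modulo `X^p − 1`:
`(∑_{a∈Q} X^a)(∑_{b∈Q} X^{(p−b) mod p}) ≡ ∑_{(a,b) ∈ Q × Q} X^{(a + (p − b)) mod p}`. -/
theorem dsb_dvd_mul_sub_fold (p : ℕ) (Q : Finset ℕ) :
    (X : K[X]) ^ p - 1 ∣ (∑ a ∈ Q, (X : K[X]) ^ a) * (∑ b ∈ Q, (X : K[X]) ^ ((p - b) % p)) -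
      ∑ ab ∈ Q ×ˢ Q, (X : K[X]) ^ ((ab.1 + (p - ab.2)) % p) := by
  have hmul : (∑ a ∈ Q, (X : K[X]) ^ a) * (∑ b ∈ Q, (X : K[X]) ^ ((p - b) % p)) =
      ∑ ab ∈ Q ×ˢ Q, (X : K[X]) ^ (ab.1 + (p - ab.2) % p) := by
    rw [sum_mul_sum, sum_product]
    simp only [pow_add]
  rw [hmul, ← sum_sub_distrib]
  refine dvd_sum fun ab _ => ?_
  have h := tct_X_pow_sub_one_dvd (K := K) p (ab.1 + (p - ab.2) % p)
  rwa [Nat.add_mod_mod] at h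

/-- **Fold identity for differences** (no hypothesis on `Q ⊆ [0, p)` beyond the range): modulo `X^p − 1`,
`(∑_{a∈Q} X^a)(∑_{b∈Q} X^{(p−b) mod p}) ≡ |Q| + ∑_{n<p} #{(a,b) ∈ Q², a ≠ b : a − b ≡ n} X^n`
(the `|Q|` diagonal pairs fold to the constant term; the off-diagonal pairs are regrouped by residue). -/
theorem dsb_fold_identity (p : ℕ) (hp : 0 < p) (Q : Finset ℕ) (hQ : ∀ a ∈ Q, a < p) :
    (X : K[X]) ^ p - 1 ∣ (∑ a ∈ Q, (X : K[X]) ^ a) * (∑ b ∈ Q, (X : K[X]) ^ ((p - b) % p)) -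
      ((Q.card : K[X]) + ∑ n ∈ range p,
        ((Q.offDiag.filter (fun ab : ℕ × ℕ => (ab.1 + (p - ab.2)) % p = n)).card : K[X]) * X ^ n) := by
  classical
  have hfib : ∑ ab ∈ Q.offDiag, (X : K[X]) ^ ((ab.1 + (p - ab.2)) % p) =
      ∑ n ∈ range p, ((Q.offDiag.filter
          (fun ab : ℕ × ℕ => (ab.1 + (p - ab.2)) % p = n)).card : K[X]) * X ^ n := by
    rw [← sum_fiberwise_of_maps_to' (g := fun ab : ℕ × ℕ => (ab.1 + (p - ab.2)) % p) (t := range p)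
      (fun ab _ => mem_range.2 (Nat.mod_lt _ hp)) (fun n => (X : K[X]) ^ n)]
    refine sum_congr rfl fun n _ => ?_
    rw [sum_const, nsmul_eq_mul]
  have hdiag : ∑ ab ∈ Q.diag, (X : K[X]) ^ ((ab.1 + (p - ab.2)) % p) = (Q.card : K[X]) := by
    rw [sum_diag]
    have h1 : ∀ a ∈ Q, (X : K[X]) ^ ((a + (p - a)) % p) = 1 := fun a ha => by
      rw [Nat.add_sub_cancel' (hQ a ha).le, Nat.mod_self, pow_zero]
    rw [sum_congr rfl h1, sum_const, nsmul_eq_mul, mul_one]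
  have hsplit : ∑ ab ∈ Q ×ˢ Q, (X : K[X]) ^ ((ab.1 + (p - ab.2)) % p) =
      (Q.card : K[X]) + ∑ n ∈ range p,
        ((Q.offDiag.filter (fun ab : ℕ × ℕ => (ab.1 + (p - ab.2)) % p = n)).card : K[X]) * X ^ n := by
    rw [← diag_union_offDiag, sum_union (disjoint_diag_offDiag Q), hdiag, hfib]
  rw [← hsplit]
  exact dsb_dvd_mul_sub_fold p Q

/-- A natural-number constant polynomial has at most one monomial. -/
theorem dsb_card_support_natCast_le (m : ℕ) : ((m : K[X])).support.card ≤ 1 := by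
  have h : (C (m : K) * X ^ 0).support.card ≤ 1 := card_support_C_mul_X_pow_le_one
  rwa [pow_zero, mul_one, map_natCast] at h

/-! ## The eight-square witness -/

/-- `½(A+B)² − ½(A−B)² − ¼(P+Q)² + ¼(P−Q)² − ¼(M+T)² + ¼(M−T)² − ½(1+E)² + ½(1−E)²
 = 2AB − (PQ + MT) − 2E` whenever `4 ≠ 0` in `K`. -/
theorem dsb_eight_sum (h4 : (4 : K) ≠ 0) (A B P Q M T E : K[X]) :
    (∑ i, C ((![1 / 2, -1 / 2, -1 / 4, 1 / 4, -1 / 4, 1 / 4, -1 / 2, 1 / 2] : Fin 8 → K) i) *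
        (![A + B, A - B, P + Q, P - Q, M + T, M - T, 1 + E, 1 - E] : Fin 8 → K[X]) i ^ 2) =
      2 * (A * B) - (P * Q + M * T) - 2 * E := by
  have h2 : (2 : K) ≠ 0 := fun h => h4 (by rw [show (4 : K) = 2 * 2 by norm_num, h, mul_zero])
  have h4' : C (1 / 4 : K) * 4 = 1 := by
    rw [show (4 : K[X]) = C 4 from (map_ofNat C 4).symm, ← C_mul, ← C_1]
    congr 1; exact one_div_mul_cancel h4
  have h2' : C (1 / 2 : K) * 2 = 1 := by
    rw [show (2 : K[X]) = C 2 from (map_ofNat C 2).symm, ← C_mul, ← C_1]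
    congr 1; exact one_div_mul_cancel h2
  have hneg : C (-1 / 4 : K) = -C (1 / 4 : K) := by
    rw [← map_neg]; congr 1; ring
  have hneg2 : C (-1 / 2 : K) = -C (1 / 2 : K) := by
    rw [← map_neg]; congr 1; ring
  simp only [Fin.sum_univ_succ, Fin.sum_univ_zero, Matrix.cons_val_zero, Matrix.cons_val_succ, hneg,
    hneg2, add_zero]
  linear_combination (2 * (A * B) - 2 * E) * h2' + (-(P * Q + M * T)) * h4'

/-- **The eight-square witness.**  Let `Q ⊆ [0, N]`, `N + 1` prime, and let `u, v : ℕ → ℕ` be the ordered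
off-diagonal difference counts of `Q` (all that is used: the fold identity
`Cq · C̃q ≡ |Q| + ∑ u(n) X^n (mod X^{N+1} − 1)`) and the indicator of the non-zero quadratic residues; let
`e ≥ #{n ≤ N : u(n) ≠ v(n)}` and `N = ab + r` a tiling (`1 ≤ r`, `a ≤ N`).  Then the weights
`½, −½, −¼, ¼, −¼, ¼, −½, ½` and the bases `Cq ± C̃q`, `lowDigits a ± highDigits a b`,
`X^{ab+1} ± (1 + ⋯ + X^{r−1})`, `1 ± (|Q| + Er)` (`Er = ∑ (u(n) − v(n)) X^n`) form a cyclic representation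
of `F̄_{N+1}` of degree `< N + 1` and support-sum `≤ 4|Q| + 2(a + b + r) + 2e + 6`. -/
theorem dsb_witness (N : ℕ) [Fact (N + 1).Prime] (h4 : (4 : K) ≠ 0) (Q : Finset ℕ)
    (hQ : ∀ x ∈ Q, x < N + 1) (u v : ℕ → ℕ)
    (hfold : (X : K[X]) ^ (N + 1) - 1 ∣
      (∑ x ∈ Q, (X : K[X]) ^ x) * (∑ x ∈ Q, (X : K[X]) ^ ((N + 1 - x) % (N + 1))) -
        ((Q.card : K[X]) + ∑ n ∈ range (N + 1), (u n : K[X]) * X ^ n))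
    (hv : ∀ n, v n = if n ≠ 0 ∧ legendreSym (N + 1) n = 1 then 1 else 0)
    (e : ℕ) (he : ((range (N + 1)).filter (fun n => u n ≠ v n)).card ≤ e)
    (a b r : ℕ) (hN : N = a * b + r) (hr : 1 ≤ r) (ha : a ≤ N) :
    ∃ (c : Fin 8 → K) (g : Fin 8 → K[X]), (∀ i, (g i).natDegree < N + 1) ∧
      ((X : K[X]) ^ (N + 1) - 1 ∣ (∑ i, C (c i) * g i ^ 2) -
        ∑ m ∈ range (N + 1), C ((legendreSym (N + 1) m : ℤ) : K) * X ^ m) ∧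
      (∑ i, ((g i).support.card : ℝ)) ≤ 4 * Q.card + 2 * (a + b + r) + 2 * e + 6 := by
  have hE := rqf_err_poly_eq (K := K) (range (N + 1)) u v
  have hEc' := (rqf_card_support_err_le (K := K) (range (N + 1)) u v).trans he
  set Cq : K[X] := ∑ x ∈ Q, X ^ x with hCq
  set Ct : K[X] := ∑ x ∈ Q, X ^ ((N + 1 - x) % (N + 1)) with hCt
  set M : K[X] := X ^ (a * b + 1) with hM
  set T : K[X] := ∑ k ∈ range r, X ^ k with hT
  set Er : K[X] := ∑ n ∈ range (N + 1), C ((u n : K) - (v n : K)) * X ^ n with hEr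
  set E' : K[X] := (Q.card : K[X]) + Er with hE'
  refine ⟨![1 / 2, -1 / 2, -1 / 4, 1 / 4, -1 / 4, 1 / 4, -1 / 2, 1 / 2],
    ![Cq + Ct, Cq - Ct, lowDigits K a + highDigits K a b, lowDigits K a - highDigits K a b, M + T, M - T,
      1 + E', 1 - E'], ?_, ?_, ?_⟩
  · -- degrees
    have hC : Cq.natDegree ≤ N :=
      natDegree_sum_le_of_forall_le _ _ fun x hx => (natDegree_X_pow_le _).trans (by
        have := hQ x hx; omega)
    have hCt' : Ct.natDegree ≤ N :=
      natDegree_sum_le_of_forall_le _ _ fun x _ => (natDegree_X_pow_le _).trans (by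
        have := Nat.mod_lt (N + 1 - x) (show 0 < N + 1 by omega); omega)
    have hl : (lowDigits K a).natDegree ≤ N := (natDegree_lowDigits a).trans ha
    have hh : (highDigits K a b).natDegree ≤ N :=
      (natDegree_highDigits a b).trans (le_trans (Nat.mul_le_mul_left a (Nat.sub_le b 1)) (by omega))
    have hM' : M.natDegree ≤ N := (natDegree_X_pow_le _).trans (by omega)
    have hT' : T.natDegree ≤ N :=
      natDegree_sum_le_of_forall_le _ _ fun k hk => (natDegree_X_pow_le _).trans (by
        have := mem_range.mp hk; omega)
    have hEd : Er.natDegree ≤ N :=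
      natDegree_sum_le_of_forall_le _ _ fun n hn => (natDegree_C_mul_X_pow_le _ _).trans (by
        have := mem_range.mp hn; omega)
    have hE'd : E'.natDegree ≤ N :=
      (natDegree_add_le _ _).trans (max_le (by rw [natDegree_natCast]; exact Nat.zero_le N) hEd)
    have h1 : (1 : K[X]).natDegree ≤ N := by simp
    intro i
    refine Nat.lt_succ_of_le ?_
    fin_cases i
    · exact (natDegree_add_le _ _).trans (max_le hC hCt')
    · exact (natDegree_sub_le _ _).trans (max_le hC hCt')
    · exact (natDegree_add_le _ _).trans (max_le hl hh)
    · exact (natDegree_sub_le _ _).trans (max_le hl hh)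
    · exact (natDegree_add_le _ _).trans (max_le hM' hT')
    · exact (natDegree_sub_le _ _).trans (max_le hM' hT')
    · exact (natDegree_add_le _ _).trans (max_le h1 hE'd)
    · exact (natDegree_sub_le _ _).trans (max_le h1 hE'd)
  · -- the cyclic identity: 2 Cq Ct − Ones − 2(|Q| + Er) ≡ 2 Rv − Ones since Cq Ct − |Q| ≡ Ru = Rv + Er
    rw [dsb_eight_sum h4, hM, hT, ← ones_digit_identity a b r, ← hN, rqf_fekete_eq (N + 1) v hv,
      Nat.add_sub_cancel]
    convert hfold.mul_left 2 using 1
    rw [hE', ← hE]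
    ring
  · -- support-sum bookkeeping
    have hC : (Cq.support.card : ℝ) ≤ Q.card := by
      exact_mod_cast card_support_sum_X_pow_le Q (fun x => x)
    have hCt' : (Ct.support.card : ℝ) ≤ Q.card := by
      exact_mod_cast card_support_sum_X_pow_le Q (fun x => (N + 1 - x) % (N + 1))
    have hl : ((lowDigits K a).support.card : ℝ) ≤ a := by exact_mod_cast card_support_lowDigits a
    have hh : ((highDigits K a b).support.card : ℝ) ≤ b := by
      exact_mod_cast card_support_highDigits a b
    have hM' : (M.support.card : ℝ) ≤ 1 := by exact_mod_cast card_support_X_pow_le _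
    have hT' : (T.support.card : ℝ) ≤ r := by
      have : T.support.card ≤ r := (card_support_sum_X_pow_le (range r) id).trans (by simp)
      exact_mod_cast this
    have hEc : (Er.support.card : ℝ) ≤ e := by exact_mod_cast hEc'
    have hQc : (((Q.card : K[X])).support.card : ℝ) ≤ 1 := by
      exact_mod_cast dsb_card_support_natCast_le (K := K) Q.card
    have h1 : ((1 : K[X]).support.card : ℝ) ≤ 1 := by
      have := card_support_X_pow_le (K := K) 0
      rw [pow_zero] at this; exact_mod_cast this
    -- `|supp (A ± B)| ≤ |supp A| + |supp B|` for the composite bases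
    have hadd := fun (A B : K[X]) => (Nat.cast_le (α := ℝ)).2 (card_support_add_le A B)
    have hsub := fun (A B : K[X]) => (Nat.cast_le (α := ℝ)).2 (card_support_sub_le A B)
    have e0 := hadd (Q.card : K[X]) Er
    have e1 := hadd Cq Ct
    have e2 := hsub Cq Ct
    have e3 := hadd (lowDigits K a) (highDigits K a b)
    have e4 := hsub (lowDigits K a) (highDigits K a b)
    have e5 := hadd M T
    have e6 := hsub M T
    have e7 := hadd 1 E'
    have e8 := hsub 1 E'
    push_cast at e0 e1 e2 e3 e4 e5 e6 e7 e8
    simp only [Fin.sum_univ_succ, Fin.sum_univ_zero, Matrix.cons_val_zero, Matrix.cons_val_succ, add_zero]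
    rw [hE'] at e7 e8 ⊢
    linarith

/-! ## The wall, robust form: the QR indicator is far from every ordered difference function -/

/-- **Ordered differences are far from the quadratic residues (from the crux).**  `CharPSparseSOS` (with
its exponent `δ`) implies: for all large primes `p` and every `Q ⊆ [0, p)`,
`p^{1/2+δ} ≤ 4|Q| + 2·#{n < p : d_Q(n) ≠ 1_QR(n)} + 13√p + 13`, where
`d_Q(n) = #{(a,b) ∈ Q × Q : a ≠ b, a − b ≡ n (mod p)}` (written `(a + (p − b)) % p = n`) and
`1_QR(n) = [n ≠ 0 ∧ (n|p) = 1]`.  Indeed the eight-square witness `dsb_witness` is a cyclic representation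
of `F̄_p` of degree `< p` with `8 ≤ p^δ` squares and support-sum `≤ 4|Q| + 2e + 6√p + 10`.  The exact case
`e = 0` is the Lev–Sonn unique-difference problem (settled by Kalmynin 2025 via Hanson–Petridis polynomials:
only `p = 5, 13`); this is its power-saving form, which is not in print. -/
theorem dQ_far_from_QR_of_charPSparseSOS :
    Summit.ValiantsHypothesis.ValiantsHypothesis.Theses.FeketeSOS.CharPSparseSOS →
      ∃ δ : ℝ, 0 < δ ∧ ∃ p₁ : ℕ, ∀ (p : ℕ) [Fact p.Prime], p₁ ≤ p → ∀ Q : Finset ℕ, (∀ a ∈ Q, a < p) →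
        (p : ℝ) ^ (1 / 2 + δ) ≤ 4 * (Q.card : ℝ) +
          2 * (((Finset.range p).filter (fun n =>
              (Q.offDiag.filter (fun ab : ℕ × ℕ => (ab.1 + (p - ab.2)) % p = n)).card ≠
                (if n ≠ 0 ∧ legendreSym p n = 1 then 1 else 0))).card : ℝ) +
          13 * Real.sqrt p + 13 := by
  rintro ⟨δ, hδ, p₀, hmain⟩
  refine ⟨δ, hδ, max (max p₀ (⌈(8 : ℝ) ^ (1 / δ)⌉₊ + 2)) 5, ?_⟩
  intro p _ hp Q hQ
  have hpprime : p.Prime := Fact.out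
  have hp5 : 5 ≤ p := le_of_max_le_right hp
  have hp₀ : p₀ ≤ p := le_of_max_le_left (le_of_max_le_left hp)
  have hceil' : ⌈(8 : ℝ) ^ (1 / δ)⌉₊ + 2 ≤ p := le_of_max_le_right (le_of_max_le_left hp)
  have h4 : (4 : ZMod p) ≠ 0 := four_ne_zero_zmod p hp5
  obtain ⟨N, rfl⟩ : ∃ N, p = N + 1 := ⟨p - 1, (Nat.succ_pred_eq_of_pos hpprime.pos).symm⟩
  -- digits of N = p - 1 (as in `no_qrPerfectSumSet_of_charPSparseSOS`): N = a * b + r, 1 ≤ r ≤ a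
  set a := Nat.sqrt N with ha
  set b := (N - 1) / a with hb
  set r := N - a * b with hr
  have hN4 : 4 ≤ N := by omega
  have ha1 : 1 ≤ a := by rw [ha]; exact Nat.le_sqrt.mpr (by nlinarith)
  have hdm : N - 1 = a * b + (N - 1) % a := by rw [hb]; exact (Nat.div_add_mod (N - 1) a).symm
  have hmod : (N - 1) % a < a := Nat.mod_lt _ ha1
  have hNabr : N = a * b + r := by omega
  have hr1 : 1 ≤ r := by omega
  have hra : r ≤ a := by omega
  have haa : a * a ≤ N := by rw [ha]; exact Nat.sqrt_le N
  have hNlt : N < (a + 1) * (a + 1) := by rw [ha]; exact Nat.lt_succ_sqrt N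
  have hb_le : b ≤ a + 2 := by
    rw [hb]
    have : N - 1 ≤ a * (a + 2) := by
      have : N ≤ a * (a + 2) := by nlinarith
      omega
    calc (N - 1) / a ≤ (a * (a + 2)) / a := Nat.div_le_div_right this
      _ = a + 2 := Nat.mul_div_cancel_left _ ha1
  have haN : a ≤ N := (Nat.le_mul_self a).trans haa
  -- the crux applied to the eight-square witness
  obtain ⟨c, g, hdeg, hdvd, hsupp⟩ := dsb_witness N h4 Q hQ
    (fun n => (Q.offDiag.filter (fun ab : ℕ × ℕ => (ab.1 + (N + 1 - ab.2)) % (N + 1) = n)).card)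
    (fun n => if n ≠ 0 ∧ legendreSym (N + 1) n = 1 then 1 else 0)
    (dsb_fold_identity (N + 1) (Nat.succ_pos N) Q hQ) (fun n => rfl)
    (((range (N + 1)).filter (fun n =>
        (Q.offDiag.filter (fun ab : ℕ × ℕ => (ab.1 + (N + 1 - ab.2)) % (N + 1) = n)).card ≠
          (if n ≠ 0 ∧ legendreSym (N + 1) n = 1 then 1 else 0))).card) le_rfl
    a b r hNabr hr1 haN
  have key := hmain (N + 1) hp₀ (ZMod (N + 1)) 8 c g
  -- reals
  have hceil : (8 : ℝ) ^ (1 / δ) ≤ ((N + 1 : ℕ) : ℝ) := by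
    have h1 : (⌈(8 : ℝ) ^ (1 / δ)⌉₊ : ℝ) ≤ ((N + 1 : ℕ) : ℝ) := by
      have : ⌈(8 : ℝ) ^ (1 / δ)⌉₊ ≤ N + 1 := by omega
      exact_mod_cast this
    exact le_trans (Nat.le_ceil _) h1
  have hpδ : (8 : ℝ) ≤ ((N + 1 : ℕ) : ℝ) ^ δ := by
    have : ((8 : ℝ) ^ (1 / δ)) ^ δ ≤ ((N + 1 : ℕ) : ℝ) ^ δ :=
      Real.rpow_le_rpow (by positivity) hceil hδ.le
    rwa [← Real.rpow_mul (by norm_num), one_div_mul_cancel hδ.ne', Real.rpow_one] at this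
  have hs : ((8 : ℕ) : ℝ) ≤ ((N + 1 : ℕ) : ℝ) ^ δ := by exact_mod_cast hpδ
  have hbound := key hs hdeg hdvd
  -- bookkeeping: 2(a + b + r) + 6 ≤ 6a + 10 ≤ 6√p + 10 ≤ 13√p + 13
  have hb' : (b : ℝ) ≤ a + 2 := by exact_mod_cast hb_le
  have hr' : (r : ℝ) ≤ a := by exact_mod_cast hra
  have hsqrt : (a : ℝ) ≤ Real.sqrt ((N + 1 : ℕ) : ℝ) := by
    rw [← Real.sqrt_sq (Nat.cast_nonneg a)]
    apply Real.sqrt_le_sqrt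
    have : ((a * a : ℕ) : ℝ) ≤ ((N + 1 : ℕ) : ℝ) := by exact_mod_cast haa.trans (Nat.le_succ N)
    push_cast at this ⊢; nlinarith
  have hsq0 : (0 : ℝ) ≤ Real.sqrt ((N + 1 : ℕ) : ℝ) := Real.sqrt_nonneg _
  linarith

end

end Summit.ValiantsHypothesis.ValiantsHypothesis.Theorems.CharPSparseSOSTwoCusp
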